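import Summits.QuantumFields.BalabanUV.Beta.FP.PerfectTelescopingFiniteComposite

/-!
# `BalabanUV.Beta.FP.PerfectTelescopingBottomFinite` — road «FP» for binder row D1, sub-row **MS-1-BOT (ii)** (owner d1-p3 gen 12, `LEAVES-FP.md` l.546;
# design `HOME/b2b-balaban-beta-d1-p3/JETS-JM-DESIGN.md` v2 §4 (a)(b)): **THE BOTTOM PAIR TELESCOPING AT FINITE `j`** — on transverse test forms the
# `(j, m+1)`-resolvent's field–field block is the `(j, 1)`-resolvent's plus the `(j, 1)`-minimisers sandwiching THE `m`-FOLD RESOLVENT OF THE NEXT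
# LEVEL `KTot (Lc^(j+1+m)) (Lc^(j+1))` lifted by `Lc` — «Γ_{(j,m+1)} = Γ_{(j,1)} + ℋ_{(j,1)}·lift_{Lc}(Γ_{(j+1,m)})·ℋ_{(j,1)}ᵀ», the NEW STEP AT THE BOTTOM
# (the tree's `PerfectTelescopingFinite*` put it on TOP), EXACTLY, every `d`, `Lc ≥ 1`, `j`, `m`

HONEST DEPENDENCY (page 1, mandatory): continuum YM on T⁴ ⇐ BetaPertH ∧ nine spine estimates (0/9 proved); BetaPertH ⇐ (D1) ∧ (D4) ∧ CAP+tail;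
G-an2-4 gates asym, D1 and NE2/3/4.  HONEST FRAMING (cell contract, verbatim): «discharging `BetaPertH` makes Bałaban's UV stability UNCONDITIONAL —
a real constructive-QFT result; it is NOT the continuum limit and NOT the Clay problem.»  THIS MODULE is [folklore] lattice bookkeeping over an5's
two-level decomposition at ARBITRARY level pair `(M, L)`, `N′ = M·L` (`ResolventCompositionStepB.pairing_identity`, `pair_PQ`, `tsum_pair_eq_sum`,
`exists_support_finset`; `ResolventComposition.tsum_sublattice₀`, `GamΦ_eq_neg_wH`, `summable_wH_sub_zsmul`; `OneStepResolventKernel.KInv_inl_inr_coarse`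
∕ `KInv_inr_inl_coarse`) read at `(M, L) = (Lc^(j+1), Lc^m)` instead of the tree's `(Lc^(j+m), Lc)`, and over this lineage's MS-1-FIN finite layer
(`PerfectTelescopingFinite.pair_contourSumAdj_eq_pair_dec` ∕ `dec_sub` ∕ `support_contourSumAdj_finite` ∕ `codiff₁_contourSumAdj_eq_zero`,
`PerfectTelescopingFiniteComposite.comp_liftW_comp_apply` ∕ `finsum_tsum_comm₁` ∕ `KTot_inl_inr_zsmul` ∕ `KTot_inr_inl_zsmul`).  No `def`, no
`def … : Prop`, nothing cited, nothing of Bałaban's asserted, 0 sorry; UNCONDITIONAL identities between the road's OWN objects.  0∕4 row-D1 binders;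
NOT (SDF), NOT D1, NOT `BetaPertH`, NOT continuum, NOT Clay.

ABSOLUTE RULE (cell charter, verbatim): «No internally-minted statement may enter as a cited fact. Every hypothesis is either kernel-proved in
this package or a verbatim quotation of a PUBLISHED theorem with page reference. The manuscript(s) under audit are NOT citable for their own
disputed steps — they are the thing under adjudication; programme-internal (2001/route/tribunal) claims are never citable.»

WHY (JETS-JM v2 §4 (a): the END's `hSDF` is the BOTTOM Fubini split `Z_{L·L^m}(V) = Z_L(𝓘_{L^m} V)·Z′_{L^m}(V)`; (b): the K-bricks landed are TOP —
`PerfectTelescopingHolds.kPerf_pair_telescoping_holds` «Γ_{Lc^{m+1}} = Γ_{Lc^m} + H_{Lc^m} C^{[Lc^m]} H_{Lc^m}ᵀ»; MS-1-BOT (ii) asks the bottom form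
«Γ_{Lc^{m+1}} = Γ_{Lc} + ℋ_{Lc}·lift_{Lc}(Γ_{Lc^m})·ℋ_{Lc}ᵀ» at the limit; (i) = the owner's `PerfectColumnSemigroup` ✓).  an5's `pairing_identity` holds for
EVERY factorisation `N′ = M·L`; the tree's `k1aTrans` is its reading at `(M, L) = (Lc^j, Lc)` with the middle kernel `KInvStep Lc j = KTot (Lc^(j+1)) (Lc^j)`
(`compA_apply`, `KInvStep_inl_inl`).  Here the SAME identity is read at `(M, L) = (Lc^(j+1), Lc^m)`: the middle kernel is the `m`-fold resolvent on the
next lattice `KTot (Lc^(j+1+m)) (Lc^(j+1))` (its field–field block is again `(M^{d+2})⁻²` times the double block-contour sum `GQ`), the outer factors are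
the ONE-step resolvent `KInv_{Lc^(j+1)}`; read through `dec (Lc^j)` the outer factors become `KTot (Lc^(j+1)) (Lc^j)` and the lift factor `Lc`.

CONTENT (every `d`, `Lc ≥ 1` (`[NeZero Lc]`), all `j, m`; `x′, y′` on the step-`j` lattice).
* §1 [folklore] `KTot_inl_inl_eq_GQ` (generalises `KInvStep_inl_inl`), `KTot_inl_inr_zsmul_one` ∕ `KTot_inr_inl_zsmul_one` (the tree's mixed blocks at `m = 1`
  with the coarse point written `Lc•z′`).
* §2 [folklore] **`compB_apply`** ∕ `compB_eq_neg_PQ` — an5's `compA_apply` with the `m`-fold middle kernel: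
  `[KInv_{Lc^(j+1)} ∘ liftW (Lc^(j+1)) true true (KTot (Lc^(j+1+m)) (Lc^(j+1))) ∘ KInv_{Lc^(j+1)}]_ff = −PQ_{Lc^(j+1+m), Lc^(j+1)}`.
* §3 [folklore] **`k1aBottom`** — an5's transverse identity at `(M, L) = (Lc^(j+1), Lc^m)` on the fine lattice (co-closed finitely supported test forms).
* §4 [folklore] **`kTot_pair_telescoping_bottom`** — read on the step-`j` lattice through `dec (Lc^j)`;  **`dec_compB_apply`**, **`dec_compB_eq_comp_KTot`**
  (`dec (Lc^j)` of the composite `= ((Lc^j)^(d+2))²·[KTot_{j,1} ∘ liftW Lc true true KTot_{j+1,m} ∘ KTot_{j,1}]_ff`), **`kTot_pair_telescoping_bottom_step`**.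
NOT HERE (honest): units, the limit `j → ∞`, the perfect objects — `FP/PerfectTelescopingBottom`.
Unit `b2b-balaban-gan24-formalise-leaf-05` (gen 42; author of MS-1-FIN gen 33), road «FP» sub-row MS-1-BOT (ii) (INTENT journal 2026-08-21 l.31218).
-/

noncomputable section

namespace Summit.QuantumFields.BalabanUV.Beta.FP.PerfectTelescopingBottomFinite

open Finset
open scoped BigOperators
open Literature.Probability.LatticeModels (TorusSite Torus.proj)
open Literature.MathematicalPhysics.QuantumFieldTheory.Balaban1983to89
open Literature.MathematicalPhysics.QuantumFieldTheory.Balaban1983to89.Beta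
open AffineAveraging (Form1 codiff₁)
open AffineReproduction (contourSumAdj)
open ExpKernelCalculus (MKer comp)
open KernelSpecInstance (wH)
open KKTFluctuationKernel (Gam)
open KKTFluctuationEnergy (Gam_symm summable_mul_of_bdd summable_mul_of_bdd')
open OneStepResolventKernel (Fib KInv KInv_inl_inl KInv_inl_inr_coarse KInv_inr_inl_coarse)
open OneStepKernelFamily (dec legPt legW legSet LegIdx KInvStep)
open InterLevelTransport (liftW slotW liftW_zsmul liftW_inl_left liftW_inl_right liftW_off slotW_true)
open StepDriftWitness (sum_LegIdx_eq_contourSum dec_inl_inr)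
open ResolventComposition (tsum_sublattice₀ GamΦ_eq_neg_wH summable_wH_sub_zsmul dec_inr_inl slot_true)
open ResolventCompositionStepB (GQ GQ_bdd PQ pair_PQ pairing_identity tsum_pair_eq_sum exists_support_finset abs_tsum_finsum_mul_le l1n dec_inl_inl)
open Summit.QuantumFields.BalabanUV.Beta.FP.PerfectObjects (KTot KTot_def)
open Summit.QuantumFields.BalabanUV.Beta.FP.PerfectTelescopingFinite (pair_contourSumAdj_eq_pair_dec dec_sub support_contourSumAdj_finite
  codiff₁_contourSumAdj_eq_zero)
open Summit.QuantumFields.BalabanUV.Beta.FP.PerfectTelescopingFiniteComposite (comp_liftW_comp_apply finsum_tsum_comm₁ KTot_inl_inr_zsmul KTot_inr_inl_zsmul)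

variable {d : ℕ} (Lc : ℕ) [NeZero Lc]

/-! ## §1 The field–field block of a decimated resolvent; the mixed blocks of the one-step family at `Lc`-coarse points -/

omit [NeZero Lc] in
/-- [folklore] **THE FIELD–FIELD BLOCK OF `KTot n M` IS `(M^{d+2})⁻²` TIMES THE DOUBLE `M`-BLOCK-CONTOUR SUM OF `Γ_n`** (an5's `KInvStep_inl_inl` for every `n`). -/
theorem KTot_inl_inl_eq_GQ (n M : ℕ) [NeZero n] (μ ν : Fin (d + 1)) (z' w' : Fin (d + 1) → ℤ) :
    KTot (d := d) n M z' w' (Sum.inl μ) (Sum.inl ν)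
      = (((M : ℝ)) ^ (d + 2))⁻¹ * ((((M : ℝ)) ^ (d + 2))⁻¹ * GQ (N := n) M μ z' ν w') := by
  rw [KTot_def]
  unfold GQ
  rw [dec_inl_inl, ← sum_LegIdx_eq_contourSum, Finset.mul_sum, Finset.mul_sum]
  refine Finset.sum_congr rfl fun i _ => ?_
  rw [← sum_LegIdx_eq_contourSum, Finset.mul_sum, Finset.mul_sum]
  refine Finset.sum_congr rfl fun i' _ => ?_
  rw [KInv_inl_inl, show KKTFluctuationEnergy.Gcol (N := n) μ (legPt M (Sum.inl μ) z' i) ν (legPt M (Sum.inl ν) w' i')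
    = Gam (N := n) ν (legPt M (Sum.inl ν) w' i') μ (legPt M (Sum.inl μ) z' i) from rfl, Gam_symm]
  ring

/-- [folklore] the `(inl, inr)` block of the one-step family at an `Lc`-coarse second argument (the tree's `KTot_inl_inr_zsmul` at `m = 1`, coarse point `Lc•z′`). -/
theorem KTot_inl_inr_zsmul_one (j : ℕ) (κ μ : Fin (d + 1)) (x' z' : Fin (d + 1) → ℤ) :
    KTot (d := d) (Lc ^ (j + 1)) (Lc ^ j) x' (((Lc : ℕ) : ℤ) • z') (Sum.inl κ) (Sum.inr μ)
      = ((((Lc ^ j : ℕ) : ℝ)) ^ (d + 2))⁻¹ * ∑ i ∈ LegIdx d (Lc ^ j),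
          wH (N := Lc ^ (j + 1)) (d := d) κ μ (legPt (Lc ^ j) (Sum.inl κ : Fib d) x' i - ((Lc ^ (j + 1) : ℕ) : ℤ) • z') := by
  have h := KTot_inl_inr_zsmul (d := d) Lc j 1 κ μ x' z'
  rw [pow_one] at h
  exact h

/-- [folklore] the `(inr, inl)` block of the one-step family at an `Lc`-coarse first argument (the tree's `KTot_inr_inl_zsmul` at `m = 1`). -/
theorem KTot_inr_inl_zsmul_one (j : ℕ) (ν l : Fin (d + 1)) (w' y' : Fin (d + 1) → ℤ) :
    KTot (d := d) (Lc ^ (j + 1)) (Lc ^ j) (((Lc : ℕ) : ℤ) • w') y' (Sum.inr ν) (Sum.inl l)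
      = -(((((Lc ^ j : ℕ) : ℝ)) ^ (d + 2))⁻¹ * ∑ i' ∈ LegIdx d (Lc ^ j),
          wH (N := Lc ^ (j + 1)) (d := d) l ν (legPt (Lc ^ j) (Sum.inl l : Fib d) y' i' - ((Lc ^ (j + 1) : ℕ) : ℤ) • w')) := by
  have h := KTot_inr_inl_zsmul (d := d) Lc j 1 ν l w' y'
  rw [pow_one] at h
  exact h

/-! ## §2 The fine composite with the `m`-fold middle kernel -/

/-- [folklore] **an5's `compA_apply` WITH THE `m`-FOLD MIDDLE KERNEL**: `[KInv_{Lc^(j+1)} ∘ liftW (Lc^(j+1)) true true (KTot (Lc^(j+1+m)) (Lc^(j+1))) ∘ KInv_{Lc^(j+1)}]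
(x, y; inl κ, inl l) = −Σ'_{z′} Σ_μ wH κ μ (x − Lc^(j+1)•z′) · Σ'_{w′} Σ_ν GQ_{Lc^(j+1+m), Lc^(j+1)}(μ, z′; ν, w′) · wH l ν (y − Lc^(j+1)•w′)`. -/
theorem compB_apply (j m : ℕ) (x y : Fin (d + 1) → ℤ) (κ l : Fin (d + 1)) :
    comp (KInv (N := Lc ^ (j + 1)) (d := d))
        (comp (liftW (Lc ^ (j + 1)) true true (KTot (d := d) (Lc ^ (j + 1 + m)) (Lc ^ (j + 1)))) (KInv (N := Lc ^ (j + 1)) (d := d)))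
        x y (Sum.inl κ) (Sum.inl l)
      = -∑' z' : (Fin (d + 1) → ℤ), ∑ μ : Fin (d + 1), wH (N := Lc ^ (j + 1)) (d := d) κ μ (x - ((Lc ^ (j + 1) : ℕ) : ℤ) • z')
          * ∑' w' : (Fin (d + 1) → ℤ), ∑ ν : Fin (d + 1), GQ (N := Lc ^ (j + 1 + m)) (Lc ^ (j + 1)) μ z' ν w'
            * wH (N := Lc ^ (j + 1)) (d := d) l ν (y - ((Lc ^ (j + 1) : ℕ) : ℤ) • w') := by
  haveI : NeZero (Lc ^ (j + 1)) := ⟨pow_ne_zero _ (NeZero.ne Lc)⟩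
  haveI : NeZero (Lc ^ (j + 1 + m)) := ⟨pow_ne_zero _ (NeZero.ne Lc)⟩
  have hC : (((Lc ^ (j + 1) : ℕ) : ℝ) ^ (d + 2)) ≠ 0 :=
    pow_ne_zero _ (by exact_mod_cast (pow_pos (Nat.pos_of_ne_zero (NeZero.ne Lc)) (j + 1)).ne')
  unfold ExpKernelCalculus.comp
  rw [← tsum_neg]
  refine tsum_sublattice₀ (Lc ^ (j + 1)) _ _ (fun z hz => ?_) (fun z' => ?_)
  · simp only [liftW_off (Lc ^ (j + 1)) true true _ (Or.inl hz), zero_mul, Finset.sum_const_zero, tsum_zero, mul_zero]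
  · rw [Fintype.sum_sum_type]
    simp only [liftW_inl_left, zero_mul, Finset.sum_const_zero, tsum_zero, mul_zero, zero_add]
    rw [← Finset.sum_neg_distrib]
    refine Finset.sum_congr rfl fun μ _ => ?_
    rw [KInv_inl_inr_coarse, ← mul_neg, ← tsum_neg]
    congr 1
    refine tsum_sublattice₀ (Lc ^ (j + 1)) _ _ (fun w hw => ?_) (fun w' => ?_)
    · simp only [liftW_off (Lc ^ (j + 1)) true true _ (Or.inr hw), zero_mul, Finset.sum_const_zero]
    · rw [Fintype.sum_sum_type]
      simp only [liftW_inl_right, zero_mul, Finset.sum_const_zero, zero_add, liftW_zsmul, KInv_inr_inl_coarse,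
        GamΦ_eq_neg_wH, slotW_true, slot_true, KTot_inl_inl_eq_GQ]
      rw [← Finset.sum_neg_distrib]
      refine Finset.sum_congr rfl fun ν _ => ?_
      field_simp

/-- [folklore] `compB_apply` in an5's `PQ` currency: the field–field entry of the composite is `−PQ_{Lc^(j+1+m), Lc^(j+1)}`. -/
theorem compB_eq_neg_PQ (j m : ℕ) (x y : Fin (d + 1) → ℤ) (κ l : Fin (d + 1)) :
    comp (KInv (N := Lc ^ (j + 1)) (d := d))
        (comp (liftW (Lc ^ (j + 1)) true true (KTot (d := d) (Lc ^ (j + 1 + m)) (Lc ^ (j + 1)))) (KInv (N := Lc ^ (j + 1)) (d := d)))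
        x y (Sum.inl κ) (Sum.inl l) = -PQ (N := Lc ^ (j + 1 + m)) (Lc ^ (j + 1)) x y κ l :=
  compB_apply Lc j m x y κ l

/-! ## §3 an5's transverse identity at `(M, L) = (Lc^(j+1), Lc^m)` -/

/-- [folklore] **THE BOTTOM TWO-LEVEL IDENTITY ON THE FINE LATTICE (transverse)**: for finitely supported CO-CLOSED `F, F′`,
`⟨F, [KInv_{Lc^(j+1+m)}]_ff F′⟩ = ⟨F, ([KInv_{Lc^(j+1)}] − [KInv_{Lc^(j+1)} ∘ liftW (Lc^(j+1)) true true (KTot (Lc^(j+1+m)) (Lc^(j+1))) ∘ KInv_{Lc^(j+1)}])_ff F′⟩` —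
an5's `pairing_identity` at `N′ = Lc^(j+1)·Lc^m` + `pair_PQ` + `compB_eq_neg_PQ` (the proof of `k1aTrans`, verbatim, with the other factorisation). -/
theorem k1aBottom (j m : ℕ) (F F' : Form1 (d + 1) ℝ)
    (hF : ∀ κ, (Function.support (F κ)).Finite) (hF' : ∀ κ, (Function.support (F' κ)).Finite)
    (hcoF : codiff₁ F = 0) (hcoF' : codiff₁ F' = 0) :
    (∑' x : (Fin (d + 1) → ℤ), ∑' y : (Fin (d + 1) → ℤ), ∑ κ : Fin (d + 1), ∑ l : Fin (d + 1),
        F κ x * KInv (N := Lc ^ (j + 1 + m)) (d := d) x y (Sum.inl κ) (Sum.inl l) * F' l y)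
      = ∑' x : (Fin (d + 1) → ℤ), ∑' y : (Fin (d + 1) → ℤ), ∑ κ : Fin (d + 1), ∑ l : Fin (d + 1),
        F κ x * (KInv (N := Lc ^ (j + 1)) (d := d) x y (Sum.inl κ) (Sum.inl l) -
          comp (KInv (N := Lc ^ (j + 1)) (d := d))
            (comp (liftW (Lc ^ (j + 1)) true true (KTot (d := d) (Lc ^ (j + 1 + m)) (Lc ^ (j + 1)))) (KInv (N := Lc ^ (j + 1)) (d := d)))
            x y (Sum.inl κ) (Sum.inl l)) * F' l y := by
  haveI : NeZero (Lc ^ (j + 1)) := ⟨pow_ne_zero _ (NeZero.ne Lc)⟩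
  haveI : NeZero (Lc ^ (j + 1 + m)) := ⟨pow_ne_zero _ (NeZero.ne Lc)⟩
  haveI : NeZero (Lc ^ m) := ⟨pow_ne_zero _ (NeZero.ne Lc)⟩
  obtain ⟨s, hs⟩ := exists_support_finset F hF
  obtain ⟨s', hs'⟩ := exists_support_finset F' hF'
  have hN : Lc ^ (j + 1 + m) = Lc ^ (j + 1) * Lc ^ m := pow_add Lc (j + 1) m
  rw [tsum_pair_eq_sum F F' s s' hs hs'
      (fun x y κ l => KInv (N := Lc ^ (j + 1 + m)) (d := d) x y (Sum.inl κ) (Sum.inl l)),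
    tsum_pair_eq_sum F F' s s' hs hs'
      (fun x y κ l => KInv (N := Lc ^ (j + 1)) (d := d) x y (Sum.inl κ) (Sum.inl l)
        - comp (KInv (N := Lc ^ (j + 1)) (d := d))
            (comp (liftW (Lc ^ (j + 1)) true true (KTot (d := d) (Lc ^ (j + 1 + m)) (Lc ^ (j + 1)))) (KInv (N := Lc ^ (j + 1)) (d := d)))
            x y (Sum.inl κ) (Sum.inl l))]
  simp only [KInv_inl_inl, compB_eq_neg_PQ, sub_neg_eq_add]
  have key : ∑ x ∈ s, ∑ y ∈ s', ∑ κ, ∑ l,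
      F κ x * (Gam (N := Lc ^ (j + 1 + m)) κ x l y - Gam (N := Lc ^ (j + 1)) κ x l y) * F' l y
        = ∑ x ∈ s, ∑ y ∈ s', ∑ κ, ∑ l, F κ x * PQ (N := Lc ^ (j + 1 + m)) (Lc ^ (j + 1)) x y κ l * F' l y :=
    (pairing_identity hN F F' hF' s s' hs hs' hcoF hcoF').trans (pair_PQ (N := Lc ^ (j + 1 + m)) (Lc ^ (j + 1)) F F' s s').symm
  calc ∑ x ∈ s, ∑ y ∈ s', ∑ κ, ∑ l, F κ x * Gam (N := Lc ^ (j + 1 + m)) κ x l y * F' l y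
      = ∑ x ∈ s, ∑ y ∈ s', ∑ κ, ∑ l, (F κ x * (Gam (N := Lc ^ (j + 1 + m)) κ x l y - Gam (N := Lc ^ (j + 1)) κ x l y) * F' l y
          + F κ x * Gam (N := Lc ^ (j + 1)) κ x l y * F' l y) :=
        Finset.sum_congr rfl fun x _ => Finset.sum_congr rfl fun y _ => Finset.sum_congr rfl fun κ _ =>
          Finset.sum_congr rfl fun l _ => by ring
    _ = ∑ x ∈ s, ∑ y ∈ s', ∑ κ, ∑ l, F κ x * (Gam (N := Lc ^ (j + 1 + m)) κ x l y - Gam (N := Lc ^ (j + 1)) κ x l y) * F' l y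
          + ∑ x ∈ s, ∑ y ∈ s', ∑ κ, ∑ l, F κ x * Gam (N := Lc ^ (j + 1)) κ x l y * F' l y := by
        simp only [Finset.sum_add_distrib]
    _ = ∑ x ∈ s, ∑ y ∈ s', ∑ κ, ∑ l, F κ x * PQ (N := Lc ^ (j + 1 + m)) (Lc ^ (j + 1)) x y κ l * F' l y
          + ∑ x ∈ s, ∑ y ∈ s', ∑ κ, ∑ l, F κ x * Gam (N := Lc ^ (j + 1)) κ x l y * F' l y := by rw [key]
    _ = ∑ x ∈ s, ∑ y ∈ s', ∑ κ, ∑ l, (F κ x * PQ (N := Lc ^ (j + 1 + m)) (Lc ^ (j + 1)) x y κ l * F' l y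
          + F κ x * Gam (N := Lc ^ (j + 1)) κ x l y * F' l y) := by
        simp only [Finset.sum_add_distrib]
    _ = ∑ x ∈ s, ∑ y ∈ s', ∑ κ, ∑ l, F κ x * (Gam (N := Lc ^ (j + 1)) κ x l y + PQ (N := Lc ^ (j + 1 + m)) (Lc ^ (j + 1)) x y κ l)
          * F' l y :=
        Finset.sum_congr rfl fun x _ => Finset.sum_congr rfl fun y _ => Finset.sum_congr rfl fun κ _ =>
          Finset.sum_congr rfl fun l _ => by ring

/-! ## §4 Read on the step-`j` lattice: the bottom pair telescoping of the (j, ·)-resolvent family -/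

/-- [folklore] **THE BOTTOM PAIR TELESCOPING AT FINITE `j` (transverse form)**: for every `Lc ≥ 1`, `j, m` and all finitely supported CO-CLOSED test
1-forms `G, G′` on the step-`j` lattice,
`⟨G, [KTot (Lc^(j+1+m)) (Lc^j)]_ff G′⟩ = ⟨G, ([KTot (Lc^(j+1)) (Lc^j)] − dec (Lc^j) [KInv_{Lc^(j+1)} ∘ liftW (Lc^(j+1)) true true (KTot (Lc^(j+1+m)) (Lc^(j+1))) ∘ KInv_{Lc^(j+1)}])_ff G′⟩`
— `k1aBottom` at the lifted test forms `𝒬ᵀ_{Lc^j} G`, `𝒬ᵀ_{Lc^j} G′`, read through `pair_contourSumAdj_eq_pair_dec`. -/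
theorem kTot_pair_telescoping_bottom (j m : ℕ) (G G' : Form1 (d + 1) ℝ)
    (hG : ∀ κ, (Function.support (G κ)).Finite) (hG' : ∀ κ, (Function.support (G' κ)).Finite)
    (hcoG : codiff₁ G = 0) (hcoG' : codiff₁ G' = 0) :
    (∑' x', ∑' y', ∑ κ, ∑ l, G κ x' * KTot (d := d) (Lc ^ (j + 1 + m)) (Lc ^ j) x' y' (Sum.inl κ) (Sum.inl l) * G' l y')
      = ∑' x', ∑' y', ∑ κ, ∑ l, G κ x' *
          (KTot (d := d) (Lc ^ (j + 1)) (Lc ^ j) x' y' (Sum.inl κ) (Sum.inl l)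
            - dec (Lc ^ j) (comp (KInv (N := Lc ^ (j + 1)) (d := d))
                (comp (liftW (Lc ^ (j + 1)) true true (KTot (d := d) (Lc ^ (j + 1 + m)) (Lc ^ (j + 1)))) (KInv (N := Lc ^ (j + 1)) (d := d))))
              x' y' (Sum.inl κ) (Sum.inl l)) * G' l y' := by
  haveI : NeZero (Lc ^ j) := ⟨pow_ne_zero _ (NeZero.ne Lc)⟩
  haveI : NeZero (Lc ^ (j + 1)) := ⟨pow_ne_zero _ (NeZero.ne Lc)⟩
  haveI : NeZero (Lc ^ (j + 1 + m)) := ⟨pow_ne_zero _ (NeZero.ne Lc)⟩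
  have hM : ((((Lc ^ j : ℕ) : ℝ) ^ (d + 2)) * (((Lc ^ j : ℕ) : ℝ) ^ (d + 2))) ≠ 0 := by
    have h1 : (((Lc ^ j : ℕ) : ℝ) ^ (d + 2)) ≠ 0 := pow_ne_zero _ (by exact_mod_cast NeZero.ne (Lc ^ j))
    exact mul_ne_zero h1 h1
  have hK := k1aBottom (d := d) Lc j m (contourSumAdj (Lc ^ j) G) (contourSumAdj (Lc ^ j) G')
    (support_contourSumAdj_finite (Lc ^ j) G hG) (support_contourSumAdj_finite (Lc ^ j) G' hG')
    (codiff₁_contourSumAdj_eq_zero (Lc ^ j) G hcoG) (codiff₁_contourSumAdj_eq_zero (Lc ^ j) G' hcoG')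
  rw [pair_contourSumAdj_eq_pair_dec (Lc ^ j) (KInv (N := Lc ^ (j + 1 + m)) (d := d)) G G' hG hG'] at hK
  have hR := pair_contourSumAdj_eq_pair_dec (Lc ^ j)
    (KInv (N := Lc ^ (j + 1)) (d := d) - comp (KInv (N := Lc ^ (j + 1)) (d := d))
      (comp (liftW (Lc ^ (j + 1)) true true (KTot (d := d) (Lc ^ (j + 1 + m)) (Lc ^ (j + 1)))) (KInv (N := Lc ^ (j + 1)) (d := d))))
    G G' hG hG'
  simp only [Pi.sub_apply] at hR
  rw [hR, dec_sub] at hK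
  simp only [Pi.sub_apply, KTot_def] at hK ⊢
  exact mul_left_cancel₀ hM hK

/-- [folklore] **THE DECIMATED BOTTOM COMPOSITE IN CLOSED FORM** (field–field block):
`dec (Lc^j) [KInv_{Lc^(j+1)} ∘ liftW (Lc^(j+1)) true true KTot_{j+1,m} ∘ KInv_{Lc^(j+1)}](x′, y′; inl κ, inl l)
 = −Σ'_{z′} Σ_μ KTot_{j,1}(x′, Lc•z′; inl κ, inr μ) · Σ'_{w′} Σ_ν GQ_{Lc^(j+1+m), Lc^(j+1)}(μ, z′; ν, w′) · ((Lc^j)^{−(d+2)} Σ_{i′} wH_{Lc^(j+1)} l ν (legPt y′ i′ − Lc^(j+1)•w′))`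
(the MS-1-FIN computation `dec_compA_apply` with the other level pair). -/
theorem dec_compB_apply (j m : ℕ) (x' y' : Fin (d + 1) → ℤ) (κ l : Fin (d + 1)) :
    dec (Lc ^ j) (comp (KInv (N := Lc ^ (j + 1)) (d := d))
        (comp (liftW (Lc ^ (j + 1)) true true (KTot (d := d) (Lc ^ (j + 1 + m)) (Lc ^ (j + 1)))) (KInv (N := Lc ^ (j + 1)) (d := d))))
        x' y' (Sum.inl κ) (Sum.inl l)
      = -∑' z' : (Fin (d + 1) → ℤ), ∑ μ : Fin (d + 1), KTot (d := d) (Lc ^ (j + 1)) (Lc ^ j) x' (((Lc : ℕ) : ℤ) • z') (Sum.inl κ) (Sum.inr μ)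
          * ∑' w' : (Fin (d + 1) → ℤ), ∑ ν : Fin (d + 1), GQ (N := Lc ^ (j + 1 + m)) (Lc ^ (j + 1)) μ z' ν w'
            * (((((Lc ^ j : ℕ) : ℝ)) ^ (d + 2))⁻¹ * ∑ i' ∈ LegIdx d (Lc ^ j),
                wH (N := Lc ^ (j + 1)) (d := d) l ν (legPt (Lc ^ j) (Sum.inl l : Fib d) y' i' - ((Lc ^ (j + 1) : ℕ) : ℤ) • w')) := by
  haveI : NeZero (Lc ^ (j + 1)) := ⟨pow_ne_zero _ (NeZero.ne Lc)⟩
  haveI : NeZero (Lc ^ (j + 1 + m)) := ⟨pow_ne_zero _ (NeZero.ne Lc)⟩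
  obtain ⟨G₀, hG₀⟩ := GQ_bdd (N := Lc ^ (j + 1 + m)) (d := d) (Lc ^ (j + 1))
  have hQb : ∀ (q : Fin (d + 1) → ℤ) (μ : Fin (d + 1)) (z' : Fin (d + 1) → ℤ),
      |∑' w', ∑ ν, GQ (N := Lc ^ (j + 1 + m)) (Lc ^ (j + 1)) μ z' ν w' * wH (N := Lc ^ (j + 1)) (d := d) l ν (q - ((Lc ^ (j + 1) : ℕ) : ℤ) • w')|
        ≤ G₀ * l1n Finset.univ (fun ν w' => wH (N := Lc ^ (j + 1)) (d := d) l ν (q - ((Lc ^ (j + 1) : ℕ) : ℤ) • w')) := by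
    intro q μ z'
    rw [show (∑' w', ∑ ν, GQ (N := Lc ^ (j + 1 + m)) (Lc ^ (j + 1)) μ z' ν w' * wH (N := Lc ^ (j + 1)) (d := d) l ν (q - ((Lc ^ (j + 1) : ℕ) : ℤ) • w'))
        = ∑' w', ∑ ν, wH (N := Lc ^ (j + 1)) (d := d) l ν (q - ((Lc ^ (j + 1) : ℕ) : ℤ) • w') * GQ (N := Lc ^ (j + 1 + m)) (Lc ^ (j + 1)) μ z' ν w'
      from tsum_congr fun w' => Finset.sum_congr rfl fun ν _ => mul_comm _ _]
    exact abs_tsum_finsum_mul_le Finset.univ (fun ν => summable_wH_sub_zsmul (Lc ^ (j + 1)) l ν q) (fun ν w' => hG₀ μ z' ν w')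
  rw [ResolventCompositionStepB.dec_inl_inl]
  simp only [compB_apply]
  have step1 : ∀ (μ : Fin (d + 1)) (z' : Fin (d + 1) → ℤ),
      ∑ i' ∈ LegIdx d (Lc ^ j), ((((Lc ^ j : ℕ) : ℝ)) ^ (d + 2))⁻¹
        * ∑' w', ∑ ν, GQ (N := Lc ^ (j + 1 + m)) (Lc ^ (j + 1)) μ z' ν w'
          * wH (N := Lc ^ (j + 1)) (d := d) l ν (legPt (Lc ^ j) (Sum.inl l : Fib d) y' i' - ((Lc ^ (j + 1) : ℕ) : ℤ) • w')
      = ∑' w', ∑ ν, GQ (N := Lc ^ (j + 1 + m)) (Lc ^ (j + 1)) μ z' ν w'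
          * (((((Lc ^ j : ℕ) : ℝ)) ^ (d + 2))⁻¹ * ∑ i' ∈ LegIdx d (Lc ^ j),
              wH (N := Lc ^ (j + 1)) (d := d) l ν (legPt (Lc ^ j) (Sum.inl l : Fib d) y' i' - ((Lc ^ (j + 1) : ℕ) : ℤ) • w')) := by
    intro μ z'
    rw [finsum_tsum_comm₁ (LegIdx d (Lc ^ j)) Finset.univ (fun _ => ((((Lc ^ j : ℕ) : ℝ)) ^ (d + 2))⁻¹)
      (fun i' ν w' => GQ (N := Lc ^ (j + 1 + m)) (Lc ^ (j + 1)) μ z' ν w'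
        * wH (N := Lc ^ (j + 1)) (d := d) l ν (legPt (Lc ^ j) (Sum.inl l : Fib d) y' i' - ((Lc ^ (j + 1) : ℕ) : ℤ) • w'))
      (fun i' ν _ => summable_mul_of_bdd (fun w' => hG₀ μ z' ν w') (summable_wH_sub_zsmul (Lc ^ (j + 1)) l ν _))]
    refine tsum_congr fun w' => Finset.sum_congr rfl fun ν _ => ?_
    simp only [Finset.mul_sum]
    exact Finset.sum_congr rfl fun i' _ => by ring
  have hIb : ∀ (μ : Fin (d + 1)) (z' : Fin (d + 1) → ℤ),
      |∑' w', ∑ ν, GQ (N := Lc ^ (j + 1 + m)) (Lc ^ (j + 1)) μ z' ν w'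
          * (((((Lc ^ j : ℕ) : ℝ)) ^ (d + 2))⁻¹ * ∑ i' ∈ LegIdx d (Lc ^ j),
              wH (N := Lc ^ (j + 1)) (d := d) l ν (legPt (Lc ^ j) (Sum.inl l : Fib d) y' i' - ((Lc ^ (j + 1) : ℕ) : ℤ) • w'))|
        ≤ ∑ i' ∈ LegIdx d (Lc ^ j), |((((Lc ^ j : ℕ) : ℝ)) ^ (d + 2))⁻¹|
          * (G₀ * l1n Finset.univ (fun ν w' => wH (N := Lc ^ (j + 1)) (d := d) l ν
              (legPt (Lc ^ j) (Sum.inl l : Fib d) y' i' - ((Lc ^ (j + 1) : ℕ) : ℤ) • w'))) := by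
    intro μ z'
    rw [← step1 μ z']
    refine (Finset.abs_sum_le_sum_abs _ _).trans (Finset.sum_le_sum fun i' _ => ?_)
    rw [abs_mul]
    exact mul_le_mul_of_nonneg_left (hQb _ μ z') (abs_nonneg _)
  have eA : ∀ i : (Fin (d + 1) → ℕ) × ℕ,
      ∑ i' ∈ LegIdx d (Lc ^ j), ((((Lc ^ j : ℕ) : ℝ)) ^ (d + 2))⁻¹ * ((((Lc ^ j : ℕ) : ℝ)) ^ (d + 2))⁻¹
        * -(∑' z', ∑ μ, wH (N := Lc ^ (j + 1)) (d := d) κ μ (legPt (Lc ^ j) (Sum.inl κ : Fib d) x' i - ((Lc ^ (j + 1) : ℕ) : ℤ) • z')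
          * ∑' w', ∑ ν, GQ (N := Lc ^ (j + 1 + m)) (Lc ^ (j + 1)) μ z' ν w'
            * wH (N := Lc ^ (j + 1)) (d := d) l ν (legPt (Lc ^ j) (Sum.inl l : Fib d) y' i' - ((Lc ^ (j + 1) : ℕ) : ℤ) • w'))
      = -(((((Lc ^ j : ℕ) : ℝ)) ^ (d + 2))⁻¹ * ∑ i' ∈ LegIdx d (Lc ^ j), ((((Lc ^ j : ℕ) : ℝ)) ^ (d + 2))⁻¹
        * ∑' z', ∑ μ, wH (N := Lc ^ (j + 1)) (d := d) κ μ (legPt (Lc ^ j) (Sum.inl κ : Fib d) x' i - ((Lc ^ (j + 1) : ℕ) : ℤ) • z')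
          * ∑' w', ∑ ν, GQ (N := Lc ^ (j + 1 + m)) (Lc ^ (j + 1)) μ z' ν w'
            * wH (N := Lc ^ (j + 1)) (d := d) l ν (legPt (Lc ^ j) (Sum.inl l : Fib d) y' i' - ((Lc ^ (j + 1) : ℕ) : ℤ) • w')) := by
    intro i
    rw [Finset.mul_sum, ← Finset.sum_neg_distrib]
    exact Finset.sum_congr rfl fun i' _ => by ring
  simp only [eA]
  rw [Finset.sum_neg_distrib]
  congr 1
  have step3 : ∀ i : (Fin (d + 1) → ℕ) × ℕ,
      ∑ i' ∈ LegIdx d (Lc ^ j), ((((Lc ^ j : ℕ) : ℝ)) ^ (d + 2))⁻¹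
        * ∑' z', ∑ μ, wH (N := Lc ^ (j + 1)) (d := d) κ μ (legPt (Lc ^ j) (Sum.inl κ : Fib d) x' i - ((Lc ^ (j + 1) : ℕ) : ℤ) • z')
          * ∑' w', ∑ ν, GQ (N := Lc ^ (j + 1 + m)) (Lc ^ (j + 1)) μ z' ν w'
            * wH (N := Lc ^ (j + 1)) (d := d) l ν (legPt (Lc ^ j) (Sum.inl l : Fib d) y' i' - ((Lc ^ (j + 1) : ℕ) : ℤ) • w')
      = ∑' z', ∑ μ, wH (N := Lc ^ (j + 1)) (d := d) κ μ (legPt (Lc ^ j) (Sum.inl κ : Fib d) x' i - ((Lc ^ (j + 1) : ℕ) : ℤ) • z')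
          * ∑' w', ∑ ν, GQ (N := Lc ^ (j + 1 + m)) (Lc ^ (j + 1)) μ z' ν w'
            * (((((Lc ^ j : ℕ) : ℝ)) ^ (d + 2))⁻¹ * ∑ i' ∈ LegIdx d (Lc ^ j),
                wH (N := Lc ^ (j + 1)) (d := d) l ν (legPt (Lc ^ j) (Sum.inl l : Fib d) y' i' - ((Lc ^ (j + 1) : ℕ) : ℤ) • w')) := by
    intro i
    rw [finsum_tsum_comm₁ (LegIdx d (Lc ^ j)) Finset.univ (fun _ => ((((Lc ^ j : ℕ) : ℝ)) ^ (d + 2))⁻¹)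
      (fun i' μ z' => wH (N := Lc ^ (j + 1)) (d := d) κ μ (legPt (Lc ^ j) (Sum.inl κ : Fib d) x' i - ((Lc ^ (j + 1) : ℕ) : ℤ) • z')
        * ∑' w', ∑ ν, GQ (N := Lc ^ (j + 1 + m)) (Lc ^ (j + 1)) μ z' ν w'
          * wH (N := Lc ^ (j + 1)) (d := d) l ν (legPt (Lc ^ j) (Sum.inl l : Fib d) y' i' - ((Lc ^ (j + 1) : ℕ) : ℤ) • w'))
      (fun i' μ _ => summable_mul_of_bdd' (summable_wH_sub_zsmul (Lc ^ (j + 1)) κ μ _) (fun z' => hQb _ μ z'))]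
    refine tsum_congr fun z' => Finset.sum_congr rfl fun μ _ => ?_
    rw [← step1 μ z', Finset.mul_sum]
    exact Finset.sum_congr rfl fun i' _ => by ring
  simp only [step3]
  rw [finsum_tsum_comm₁ (LegIdx d (Lc ^ j)) Finset.univ (fun _ => ((((Lc ^ j : ℕ) : ℝ)) ^ (d + 2))⁻¹)
    (fun i μ z' => wH (N := Lc ^ (j + 1)) (d := d) κ μ (legPt (Lc ^ j) (Sum.inl κ : Fib d) x' i - ((Lc ^ (j + 1) : ℕ) : ℤ) • z')
      * ∑' w', ∑ ν, GQ (N := Lc ^ (j + 1 + m)) (Lc ^ (j + 1)) μ z' ν w'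
        * (((((Lc ^ j : ℕ) : ℝ)) ^ (d + 2))⁻¹ * ∑ i' ∈ LegIdx d (Lc ^ j),
            wH (N := Lc ^ (j + 1)) (d := d) l ν (legPt (Lc ^ j) (Sum.inl l : Fib d) y' i' - ((Lc ^ (j + 1) : ℕ) : ℤ) • w')))
    (fun i μ _ => summable_mul_of_bdd' (summable_wH_sub_zsmul (Lc ^ (j + 1)) κ μ _) (fun z' => hIb μ z'))]
  refine tsum_congr fun z' => Finset.sum_congr rfl fun μ _ => ?_
  rw [KTot_inl_inr_zsmul_one, Finset.mul_sum, Finset.sum_mul]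
  exact Finset.sum_congr rfl fun i _ => by ring

/-- [folklore] **THE DECIMATED BOTTOM COMPOSITE IS `((Lc^j)^(d+2))²` TIMES THE STEP-`j` COMPOSITE «ℋ_{(j,1)} · lift_{Lc}(Γ_{(j+1,m)}) · ℋ_{(j,1)}ᵀ»** (field–field
block): `dec (Lc^j) [KInv_{Lc^(j+1)} ∘ liftW (Lc^(j+1)) true true KTot_{j+1,m} ∘ KInv_{Lc^(j+1)}](x′,y′; inl κ, inl l)
= ((Lc^j)^(d+2))² · [KTot_{j,1} ∘ liftW Lc true true KTot_{j+1,m} ∘ KTot_{j,1}](x′,y′; inl κ, inl l)` (`KTot_{j,1} = KTot (Lc^(j+1)) (Lc^j)`,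
`KTot_{j+1,m} = KTot (Lc^(j+1+m)) (Lc^(j+1))`). -/
theorem dec_compB_eq_comp_KTot (j m : ℕ) (x' y' : Fin (d + 1) → ℤ) (κ l : Fin (d + 1)) :
    dec (Lc ^ j) (comp (KInv (N := Lc ^ (j + 1)) (d := d))
        (comp (liftW (Lc ^ (j + 1)) true true (KTot (d := d) (Lc ^ (j + 1 + m)) (Lc ^ (j + 1)))) (KInv (N := Lc ^ (j + 1)) (d := d))))
        x' y' (Sum.inl κ) (Sum.inl l)
      = ((((Lc ^ j : ℕ) : ℝ)) ^ (d + 2) * (((Lc ^ j : ℕ) : ℝ)) ^ (d + 2))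
        * comp (KTot (d := d) (Lc ^ (j + 1)) (Lc ^ j))
            (comp (liftW Lc true true (KTot (d := d) (Lc ^ (j + 1 + m)) (Lc ^ (j + 1)))) (KTot (d := d) (Lc ^ (j + 1)) (Lc ^ j)))
            x' y' (Sum.inl κ) (Sum.inl l) := by
  haveI : NeZero (Lc ^ (j + 1 + m)) := ⟨pow_ne_zero _ (NeZero.ne Lc)⟩
  have hLj : (((Lc ^ j : ℕ) : ℝ)) ^ (d + 2) ≠ 0 := pow_ne_zero _ (by exact_mod_cast pow_ne_zero _ (NeZero.ne Lc))
  have hL1 : ((Lc : ℝ)) ^ (d + 2) ≠ 0 := pow_ne_zero _ (by exact_mod_cast NeZero.ne Lc)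
  have hN : (((Lc ^ (j + 1) : ℕ) : ℝ)) ^ (d + 2) = (((Lc ^ j : ℕ) : ℝ)) ^ (d + 2) * ((Lc : ℝ)) ^ (d + 2) := by
    rw [← mul_pow]; push_cast; rw [← pow_succ]
  rw [dec_compB_apply, comp_liftW_comp_apply]
  simp only [slot_true, slotW_true, KTot_inl_inl_eq_GQ, KTot_inr_inl_zsmul_one]
  rw [← tsum_neg, ← tsum_mul_left]
  refine tsum_congr fun z' => ?_
  rw [Finset.mul_sum, ← Finset.sum_neg_distrib]
  refine Finset.sum_congr rfl fun μ _ => ?_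
  have key : (∑' w', ∑ ν, ((Lc : ℝ)) ^ (d + 2) * ((Lc : ℝ)) ^ (d + 2)
        * (((((Lc ^ (j + 1) : ℕ) : ℝ)) ^ (d + 2))⁻¹ * (((((Lc ^ (j + 1) : ℕ) : ℝ)) ^ (d + 2))⁻¹
          * GQ (N := Lc ^ (j + 1 + m)) (Lc ^ (j + 1)) μ z' ν w'))
        * -(((((Lc ^ j : ℕ) : ℝ)) ^ (d + 2))⁻¹ * ∑ i' ∈ LegIdx d (Lc ^ j),
            wH (N := Lc ^ (j + 1)) (d := d) l ν (legPt (Lc ^ j) (Sum.inl l : Fib d) y' i' - ((Lc ^ (j + 1) : ℕ) : ℤ) • w')))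
      = -((((Lc : ℝ)) ^ (d + 2) * ((Lc : ℝ)) ^ (d + 2)
          * (((((Lc ^ (j + 1) : ℕ) : ℝ)) ^ (d + 2))⁻¹ * ((((Lc ^ (j + 1) : ℕ) : ℝ)) ^ (d + 2))⁻¹))
        * ∑' w', ∑ ν, GQ (N := Lc ^ (j + 1 + m)) (Lc ^ (j + 1)) μ z' ν w'
          * (((((Lc ^ j : ℕ) : ℝ)) ^ (d + 2))⁻¹ * ∑ i' ∈ LegIdx d (Lc ^ j),
              wH (N := Lc ^ (j + 1)) (d := d) l ν (legPt (Lc ^ j) (Sum.inl l : Fib d) y' i' - ((Lc ^ (j + 1) : ℕ) : ℤ) • w'))) := by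
    rw [← tsum_mul_left, ← tsum_neg]
    refine tsum_congr fun w' => ?_
    rw [Finset.mul_sum, ← Finset.sum_neg_distrib]
    exact Finset.sum_congr rfl fun ν _ => by ring
  rw [key, hN]
  field_simp

/-- [folklore] **THE BOTTOM PAIR TELESCOPING AT FINITE `j`, K-SIDE, TRANSVERSE — «Γ_{(j,m+1)} = Γ_{(j,1)} + ℋ_{(j,1)}·lift_{Lc}(Γ_{(j+1,m)})·ℋ_{(j,1)}ᵀ».**
For every `Lc ≥ 1`, `j, m` and all finitely supported CO-CLOSED test 1-forms `G, G′` on the step-`j` lattice,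
`⟨G, [KTot (Lc^(j+1+m)) (Lc^j)]_ff G′⟩ = ⟨G, ([KTot (Lc^(j+1)) (Lc^j)] − ((Lc^j)^(d+2))²·[KTot_{j,1} ∘ liftW Lc true true KTot_{j+1,m} ∘ KTot_{j,1}])_ff G′⟩`
(the new ONE step at the BOTTOM, the `m`-fold resolvent of the next lattice lifted by `Lc`; `kTot_pair_telescoping_bottom` + `dec_compB_eq_comp_KTot`). -/
theorem kTot_pair_telescoping_bottom_step (j m : ℕ) (G G' : Form1 (d + 1) ℝ)
    (hG : ∀ κ, (Function.support (G κ)).Finite) (hG' : ∀ κ, (Function.support (G' κ)).Finite)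
    (hcoG : codiff₁ G = 0) (hcoG' : codiff₁ G' = 0) :
    (∑' x', ∑' y', ∑ κ, ∑ l, G κ x' * KTot (d := d) (Lc ^ (j + 1 + m)) (Lc ^ j) x' y' (Sum.inl κ) (Sum.inl l) * G' l y')
      = ∑' x', ∑' y', ∑ κ, ∑ l, G κ x' *
          (KTot (d := d) (Lc ^ (j + 1)) (Lc ^ j) x' y' (Sum.inl κ) (Sum.inl l)
            - ((((Lc ^ j : ℕ) : ℝ)) ^ (d + 2) * (((Lc ^ j : ℕ) : ℝ)) ^ (d + 2))
              * comp (KTot (d := d) (Lc ^ (j + 1)) (Lc ^ j))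
                  (comp (liftW Lc true true (KTot (d := d) (Lc ^ (j + 1 + m)) (Lc ^ (j + 1)))) (KTot (d := d) (Lc ^ (j + 1)) (Lc ^ j)))
                  x' y' (Sum.inl κ) (Sum.inl l)) * G' l y' := by
  rw [kTot_pair_telescoping_bottom Lc j m G G' hG hG' hcoG hcoG']
  simp only [dec_compB_eq_comp_KTot]

end Summit.QuantumFields.BalabanUV.Beta.FP.PerfectTelescopingBottomFinite

end
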